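import Mathlib.MeasureTheory.Measure.Lebesgue.VolumeOfBalls
import Mathlib.MeasureTheory.Measure.Haar.InnerProductSpace
import Mathlib.Analysis.InnerProductSpace.PiL2
import HarnessLib

/-!
# Packing count in an axis-aligned cylindrical shell: `O((b − a) ρ)` unit-separated points

HONEST FRAMING. Part of the venture `Summits/Ventures/Crystal3D` (cell `crystal3d-full`), helper for the
crux `GenericWallFloor` (stmt-Ventures-19480) of `route-Ventures-StickyWulffConstant`, line `WallLedgerG`:
module M1 (upper slab count) of the rigid-bicrystal rung of `stub_twoSlabAdhesion` (note RIGID-RUNG-ARCH on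
the item) needs the RIM of a clamped slab sample — the balls within lateral distance `1` of the cylinder wall —
to have `O(ρ)` balls (the horizontal bond classes contribute at most the rim count to the slot sum: for a
horizontal slot `w`, `p ↦ p + w` injects `{p ∈ P : p + w ∉ P}` into the rim of the sample of radius `ρ + 1`).
Elementary measure theory; nothing about lattices.

**Theorem** (`card_mul_le_of_separated_in_shell`).  A finite `1`-separated set `S ⊆ ℝ³` inside the shell
`{a ≤ z ≤ b, ρ₁² < x² + y² ≤ ρ₂²}` (`1 ≤ ρ₁ ≤ ρ₂`, `a ≤ b`) has
`#S · (π/6) ≤ (b − a + 2) · π ((ρ₂ + 1)² − (ρ₁ − 1)²)`: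
the open balls of radius `½` about the points are disjoint and lie in the enlarged shell.

WHAT THIS IS NOT: nothing about the crux; rung F-C1 not moved.
-/

noncomputable section

namespace Summit.Ventures.Crystal3D.Theorems

open MeasureTheory Set Finset Metric

/-- Volume of the axis-aligned solid cylinder `{x² + y² ≤ r², lo ≤ z ≤ hi}` (`r ≥ 0`). -/
theorem volume_cyl (r lo hi : ℝ) (hr : 0 ≤ r) :
    volume {y : EuclideanSpace ℝ (Fin 3) | y 0 ^ 2 + y 1 ^ 2 ≤ r ^ 2 ∧ lo ≤ y 2 ∧ y 2 ≤ hi} =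
      ENNReal.ofReal (hi - lo) * (ENNReal.ofReal r ^ 2 * ENNReal.ofReal Real.pi) := by
  set C' : Set (Fin 3 → ℝ) := {f | f 0 ^ 2 + f 1 ^ 2 ≤ r ^ 2 ∧ lo ≤ f 2 ∧ f 2 ≤ hi} with hC'
  have hpre : {y : EuclideanSpace ℝ (Fin 3) | y 0 ^ 2 + y 1 ^ 2 ≤ r ^ 2 ∧ lo ≤ y 2 ∧ y 2 ≤ hi} =
      (WithLp.ofLp : EuclideanSpace ℝ (Fin 3) → (Fin 3 → ℝ)) ⁻¹' C' := by
    ext y; simp [hC']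
  have hC'meas : MeasurableSet C' := by
    have h1 : Measurable fun f : Fin 3 → ℝ => f 0 ^ 2 + f 1 ^ 2 :=
      ((measurable_pi_apply (0 : Fin 3) : Measurable fun f : Fin 3 → ℝ => f 0).pow_const 2).add
        ((measurable_pi_apply (1 : Fin 3) : Measurable fun f : Fin 3 → ℝ => f 1).pow_const 2)
    have h2 : Measurable fun f : Fin 3 → ℝ => f 2 := measurable_pi_apply (2 : Fin 3)
    rw [hC']
    exact (measurableSet_le h1 measurable_const).inter
      ((measurableSet_le measurable_const h2).inter (measurableSet_le h2 measurable_const))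
  rw [hpre, (PiLp.volume_preserving_ofLp (Fin 3)).measure_preimage hC'meas.nullMeasurableSet]
  set D : Set (Fin 2 → ℝ) := {g | g 0 ^ 2 + g 1 ^ 2 ≤ r ^ 2} with hD
  have hsplit : C' = (MeasurableEquiv.piFinSuccAbove (fun _ : Fin 3 => ℝ) 2) ⁻¹'
      (Icc lo hi ×ˢ D) := by
    ext f
    simp only [hC', hD, Set.mem_setOf_eq, Set.mem_preimage, Set.mem_prod, Set.mem_Icc]
    simp [MeasurableEquiv.piFinSuccAbove, Fin.removeNth, Fin.succAbove]
    constructor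
    · rintro ⟨h1, h2, h3⟩; exact ⟨⟨h2, h3⟩, h1⟩
    · rintro ⟨⟨h2, h3⟩, h1⟩; exact ⟨h1, h2, h3⟩
  rw [hsplit, (volume_preserving_piFinSuccAbove (fun _ : Fin 3 => ℝ) 2).measure_preimage_equiv]
  rw [show (volume : Measure (ℝ × (Fin 2 → ℝ))) = volume.prod volume from rfl, Measure.prod_prod,
    Real.volume_Icc]
  have hDeq : D = (WithLp.toLp 2 : (Fin 2 → ℝ) → EuclideanSpace ℝ (Fin 2)) ⁻¹'
      Metric.closedBall (0 : EuclideanSpace ℝ (Fin 2)) r := by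
    ext g
    simp only [hD, Set.mem_setOf_eq, Set.mem_preimage, Metric.mem_closedBall, dist_zero_right]
    rw [EuclideanSpace.norm_eq, Fin.sum_univ_two]
    simp only [Real.norm_eq_abs, sq_abs]
    rw [Real.sqrt_le_left hr]
  rw [hDeq, (PiLp.volume_preserving_toLp (Fin 2)).measure_preimage
    measurableSet_closedBall.nullMeasurableSet, EuclideanSpace.volume_closedBall_fin_two]

/-- Measurability of the axis-aligned solid cylinder. -/
theorem measurableSet_cyl (r lo hi : ℝ) :
    MeasurableSet {y : EuclideanSpace ℝ (Fin 3) | y 0 ^ 2 + y 1 ^ 2 ≤ r ^ 2 ∧ lo ≤ y 2 ∧ y 2 ≤ hi} := by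
  have h0 : Measurable fun y : EuclideanSpace ℝ (Fin 3) => y 0 :=
    (measurable_pi_apply (0 : Fin 3)).comp (PiLp.volume_preserving_ofLp (Fin 3)).measurable
  have h1 : Measurable fun y : EuclideanSpace ℝ (Fin 3) => y 1 :=
    (measurable_pi_apply (1 : Fin 3)).comp (PiLp.volume_preserving_ofLp (Fin 3)).measurable
  have h2 : Measurable fun y : EuclideanSpace ℝ (Fin 3) => y 2 :=
    (measurable_pi_apply (2 : Fin 3)).comp (PiLp.volume_preserving_ofLp (Fin 3)).measurable
  exact (measurableSet_le ((h0.pow_const 2).add (h1.pow_const 2)) measurable_const).inter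
    ((measurableSet_le measurable_const h2).inter (measurableSet_le h2 measurable_const))

/-- Coordinates are `1`-Lipschitz: `(y i − p i)² ≤ dist y p ²` in `ℝ³`. -/
theorem sq_sub_apply_le_dist_sq (y p : EuclideanSpace ℝ (Fin 3)) (i : Fin 3) :
    (y i - p i) ^ 2 ≤ dist y p ^ 2 := by
  rw [EuclideanSpace.dist_eq, Real.sq_sqrt (Finset.sum_nonneg fun _ _ => sq_nonneg _)]
  simp only [Real.dist_eq, sq_abs]
  rw [Fin.sum_univ_three]
  fin_cases i <;> simp <;> nlinarith [sq_nonneg (y 0 - p 0), sq_nonneg (y 1 - p 1), sq_nonneg (y 2 - p 2)]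

/-- Lateral algebra, outer bound: `|p|² ≤ ρ²`, `|y − p|² < 1/4` (in the plane) `⇒ |y|² ≤ (ρ + 1)²`. -/
theorem lateral_outer (p0 p1 y0 y1 ρ : ℝ) (hρ : 0 ≤ ρ) (hp : p0 ^ 2 + p1 ^ 2 ≤ ρ ^ 2)
    (hd : (y0 - p0) ^ 2 + (y1 - p1) ^ 2 < 1 / 4) : y0 ^ 2 + y1 ^ 2 ≤ (ρ + 1) ^ 2 := by
  have hCS : (p0 * (y0 - p0) + p1 * (y1 - p1)) ^ 2 ≤
      (p0 ^ 2 + p1 ^ 2) * ((y0 - p0) ^ 2 + (y1 - p1) ^ 2) := by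
    nlinarith [sq_nonneg (p0 * (y1 - p1) - p1 * (y0 - p0))]
  have hpd : (p0 * (y0 - p0) + p1 * (y1 - p1)) ^ 2 ≤ (ρ / 2) ^ 2 := by
    have : (p0 ^ 2 + p1 ^ 2) * ((y0 - p0) ^ 2 + (y1 - p1) ^ 2) ≤ ρ ^ 2 * (1 / 4) :=
      mul_le_mul hp hd.le (by positivity) (by positivity)
    nlinarith
  have hpd' : p0 * (y0 - p0) + p1 * (y1 - p1) ≤ ρ / 2 := (abs_le_of_sq_le_sq' hpd (by positivity)).2
  have hexp : y0 ^ 2 + y1 ^ 2 = (p0 ^ 2 + p1 ^ 2) + 2 * (p0 * (y0 - p0) + p1 * (y1 - p1)) +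
      ((y0 - p0) ^ 2 + (y1 - p1) ^ 2) := by ring
  nlinarith

/-- Lateral algebra, inner exclusion: `|y|² ≤ (ρ − 1)²`, `|y − p|² < 1/4`, `ρ ≥ 1` `⇒ |p|² < ρ²`. -/
theorem lateral_inner (p0 p1 y0 y1 ρ : ℝ) (hρ : 1 ≤ ρ) (hy : y0 ^ 2 + y1 ^ 2 ≤ (ρ - 1) ^ 2)
    (hd : (y0 - p0) ^ 2 + (y1 - p1) ^ 2 < 1 / 4) : p0 ^ 2 + p1 ^ 2 < ρ ^ 2 := by
  have hCS : (y0 * (y0 - p0) + y1 * (y1 - p1)) ^ 2 ≤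
      (y0 ^ 2 + y1 ^ 2) * ((y0 - p0) ^ 2 + (y1 - p1) ^ 2) := by
    nlinarith [sq_nonneg (y0 * (y1 - p1) - y1 * (y0 - p0))]
  have hρ10 : 0 ≤ ρ - 1 := by linarith
  have hyd : (y0 * (y0 - p0) + y1 * (y1 - p1)) ^ 2 ≤ ((ρ - 1) / 2) ^ 2 := by
    have : (y0 ^ 2 + y1 ^ 2) * ((y0 - p0) ^ 2 + (y1 - p1) ^ 2) ≤ (ρ - 1) ^ 2 * (1 / 4) :=
      mul_le_mul hy hd.le (by positivity) (by positivity)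
    nlinarith
  have hyd' : -((ρ - 1) / 2) ≤ y0 * (y0 - p0) + y1 * (y1 - p1) :=
    (abs_le_of_sq_le_sq' hyd (by positivity)).1
  have hexp : p0 ^ 2 + p1 ^ 2 = (y0 ^ 2 + y1 ^ 2) - 2 * (y0 * (y0 - p0) + y1 * (y1 - p1)) +
      ((y0 - p0) ^ 2 + (y1 - p1) ^ 2) := by ring
  nlinarith

/-- **Packing count in a cylindrical shell.**  See the module docstring. -/
theorem card_mul_le_of_separated_in_shell (S : Finset (EuclideanSpace ℝ (Fin 3)))
    (hS : ∀ p ∈ S, ∀ q ∈ S, p ≠ q → 1 ≤ dist p q) (a b ρ₁ ρ₂ : ℝ) (hab : a ≤ b) (hρ₁ : 1 ≤ ρ₁)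
    (h12 : ρ₁ ≤ ρ₂)
    (hmem : ∀ p ∈ S, a ≤ p 2 ∧ p 2 ≤ b ∧ ρ₁ ^ 2 < p 0 ^ 2 + p 1 ^ 2 ∧ p 0 ^ 2 + p 1 ^ 2 ≤ ρ₂ ^ 2) :
    (S.card : ℝ) * (Real.pi / 6) ≤ (b - a + 2) * (Real.pi * (ρ₂ + 1) ^ 2 - Real.pi * (ρ₁ - 1) ^ 2) := by
  classical
  set Outer := {y : EuclideanSpace ℝ (Fin 3) | y 0 ^ 2 + y 1 ^ 2 ≤ (ρ₂ + 1) ^ 2 ∧ a - 1 ≤ y 2 ∧ y 2 ≤ b + 1}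
    with hOuter
  set Inner := {y : EuclideanSpace ℝ (Fin 3) | y 0 ^ 2 + y 1 ^ 2 ≤ (ρ₁ - 1) ^ 2 ∧ a - 1 ≤ y 2 ∧ y 2 ≤ b + 1}
    with hInner
  have hIO : Inner ⊆ Outer := by
    intro y hy; rw [hInner] at hy; rw [hOuter]
    refine ⟨?_, hy.2.1, hy.2.2⟩
    have : (ρ₁ - 1) ^ 2 ≤ (ρ₂ + 1) ^ 2 := by nlinarith
    exact hy.1.trans this
  set B : EuclideanSpace ℝ (Fin 3) → Set (EuclideanSpace ℝ (Fin 3)) := fun p => ball p (1 / 2) with hB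
  -- disjointness
  have hdisj : Set.PairwiseDisjoint (↑S : Set (EuclideanSpace ℝ (Fin 3))) B := by
    intro p hp q hq hpq
    rw [Function.onFun, hB]
    apply ball_disjoint_ball
    have := hS p hp q hq hpq
    linarith
  -- each ball lies in the shell `Outer \ Inner`
  have hsub : ∀ p ∈ S, B p ⊆ Outer \ Inner := by
    intro p hp y hy
    rw [hB, mem_ball] at hy
    obtain ⟨ha', hb', h1', h2'⟩ := hmem p hp
    have hd2 : dist y p ^ 2 < (1 / 2) ^ 2 := by
      have h0 := dist_nonneg (x := y) (y := p)
      exact pow_lt_pow_left₀ hy h0 two_ne_zero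
    have hz := sq_sub_apply_le_dist_sq y p 2
    -- `dd = |d|²` of the lateral displacement, `< 1/4`
    have hdd : (y 0 - p 0) ^ 2 + (y 1 - p 1) ^ 2 ≤ dist y p ^ 2 := by
      rw [EuclideanSpace.dist_eq, Real.sq_sqrt (Finset.sum_nonneg fun _ _ => sq_nonneg _)]
      simp only [Real.dist_eq, sq_abs]
      rw [Fin.sum_univ_three]; linarith [sq_nonneg (y 2 - p 2)]
    have hdd' : (y 0 - p 0) ^ 2 + (y 1 - p 1) ^ 2 < 1 / 4 := by linarith
    have hz4 : (y 2 - p 2) ^ 2 ≤ (1 / 2) ^ 2 := by linarith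
    have hz2 := abs_le_of_sq_le_sq' hz4 (by norm_num : (0 : ℝ) ≤ 1 / 2)
    have hρ₂0 : 0 ≤ ρ₂ := by linarith
    constructor
    · rw [hOuter]
      refine ⟨lateral_outer (p 0) (p 1) (y 0) (y 1) ρ₂ hρ₂0 h2' hdd', ?_, ?_⟩
      · linarith [hz2.1]
      · linarith [hz2.2]
    · intro hyI
      rw [hInner] at hyI
      have := lateral_inner (p 0) (p 1) (y 0) (y 1) ρ₁ hρ₁ hyI.1 hdd'
      linarith
  -- measure comparison
  have hvolB : ∀ p, volume (B p) = ENNReal.ofReal (1 / 2) ^ 3 * ENNReal.ofReal (Real.pi * 4 / 3) :=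
    fun p => by rw [hB]; exact EuclideanSpace.volume_ball_fin_three p (1 / 2)
  have hOvol := volume_cyl (ρ₂ + 1) (a - 1) (b + 1) (by linarith)
  have hIvol := volume_cyl (ρ₁ - 1) (a - 1) (b + 1) (by linarith)
  have hIfin : volume Inner ≠ ⊤ := by
    rw [hInner, hIvol]; exact ENNReal.mul_ne_top ENNReal.ofReal_ne_top
      (ENNReal.mul_ne_top (ENNReal.pow_ne_top ENNReal.ofReal_ne_top) ENNReal.ofReal_ne_top)
  have hle : (S.card : ENNReal) * (ENNReal.ofReal (1 / 2) ^ 3 * ENNReal.ofReal (Real.pi * 4 / 3)) ≤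
      volume Outer - volume Inner := by
    calc (S.card : ENNReal) * (ENNReal.ofReal (1 / 2) ^ 3 * ENNReal.ofReal (Real.pi * 4 / 3))
        = ∑ p ∈ S, volume (B p) := by rw [sum_congr rfl fun p _ => hvolB p, sum_const, nsmul_eq_mul]
      _ = volume (⋃ p ∈ S, B p) :=
          (measure_biUnion_finset hdisj fun p _ => by rw [hB]; exact measurableSet_ball).symm
      _ ≤ volume (Outer \ Inner) := measure_mono (Set.iUnion₂_subset hsub)
      _ = volume Outer - volume Inner := measure_sdiff hIO (measurableSet_cyl _ _ _).nullMeasurableSet hIfin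
  rw [hOuter, hOvol, hInner, hIvol] at hle
  -- convert to reals
  have hba : 0 ≤ b + 1 - (a - 1) := by linarith
  have key : (S.card : ℝ) * ((1 / 2) ^ 3 * (Real.pi * 4 / 3)) ≤
      (b + 1 - (a - 1)) * ((ρ₂ + 1) ^ 2 * Real.pi) - (b + 1 - (a - 1)) * ((ρ₁ - 1) ^ 2 * Real.pi) := by
    have hρ10 : 0 ≤ ρ₁ - 1 := by linarith
    have hρ21 : 0 ≤ ρ₂ + 1 := by linarith
    have e1 : ENNReal.ofReal (b + 1 - (a - 1)) * (ENNReal.ofReal (ρ₂ + 1) ^ 2 * ENNReal.ofReal Real.pi) =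
        ENNReal.ofReal ((b + 1 - (a - 1)) * ((ρ₂ + 1) ^ 2 * Real.pi)) := by
      rw [← ENNReal.ofReal_pow hρ21, ← ENNReal.ofReal_mul (pow_nonneg hρ21 2),
        ← ENNReal.ofReal_mul hba]
    have e2 : ENNReal.ofReal (b + 1 - (a - 1)) * (ENNReal.ofReal (ρ₁ - 1) ^ 2 * ENNReal.ofReal Real.pi) =
        ENNReal.ofReal ((b + 1 - (a - 1)) * ((ρ₁ - 1) ^ 2 * Real.pi)) := by
      rw [← ENNReal.ofReal_pow hρ10, ← ENNReal.ofReal_mul (pow_nonneg hρ10 2),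
        ← ENNReal.ofReal_mul hba]
    have e3 : (S.card : ENNReal) * (ENNReal.ofReal (1 / 2) ^ 3 * ENNReal.ofReal (Real.pi * 4 / 3)) =
        ENNReal.ofReal ((S.card : ℝ) * ((1 / 2) ^ 3 * (Real.pi * 4 / 3))) := by
      rw [← ENNReal.ofReal_pow (by norm_num), ← ENNReal.ofReal_mul (by positivity),
        ← ENNReal.ofReal_natCast, ← ENNReal.ofReal_mul (Nat.cast_nonneg _)]
    rw [e1, e2, e3] at hle
    have hsub' : ENNReal.ofReal ((b + 1 - (a - 1)) * ((ρ₂ + 1) ^ 2 * Real.pi)) -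
        ENNReal.ofReal ((b + 1 - (a - 1)) * ((ρ₁ - 1) ^ 2 * Real.pi)) ≤
        ENNReal.ofReal ((b + 1 - (a - 1)) * ((ρ₂ + 1) ^ 2 * Real.pi) -
          (b + 1 - (a - 1)) * ((ρ₁ - 1) ^ 2 * Real.pi)) := by
      rw [← ENNReal.ofReal_sub _ (by positivity)]
    have hfin := hle.trans hsub'
    have hnn : 0 ≤ (b + 1 - (a - 1)) * ((ρ₂ + 1) ^ 2 * Real.pi) -
        (b + 1 - (a - 1)) * ((ρ₁ - 1) ^ 2 * Real.pi) := by
      rw [← mul_sub]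
      apply mul_nonneg hba
      have : (ρ₁ - 1) ^ 2 ≤ (ρ₂ + 1) ^ 2 := by nlinarith
      nlinarith [Real.pi_pos]
    exact (ENNReal.ofReal_le_ofReal_iff hnn).1 hfin
  have : (1 / 2 : ℝ) ^ 3 * (Real.pi * 4 / 3) = Real.pi / 6 := by ring
  rw [this] at key
  have e4 : (b + 1 - (a - 1)) = b - a + 2 := by ring
  rw [e4] at key
  linarith

end Summit.Ventures.Crystal3D.Theorems

end
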